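import Literature.MathematicalPhysics.QuantumLattice.HubbardShiftedSliceGram
import Literature.MathematicalPhysics.QuantumLattice.FejerTopCutoff
import HarnessLib

/-!
# The exact scale decomposition of the Matsubara-shifted free covariance: Fejér top + ultraviolet block + Salmhofer slices

Topic `MathematicalPhysics/QuantumLattice`; the covariance bookkeeping of the `βU ≤ κ` corner of the Hubbard two-point function (cell
gate-hubbard-kl, R0, note R0-SCOPE-3 / ARCH-β P2).  On the finite-frequency Grassmann algebra of the Hubbard torus (`2M` Matsubara
frequencies, `HubbardFreeCovariance`) the free covariance at a COMPLEX chemical potential `μ + iθ` is the normal covariance with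
symbol `βL²/(-i(ω+θ) + ξ)` (`shiftedFreeSymbol`, `HubbardShiftedSliceCovariance`).  It is written as an EXACT finite sum of the
covariances that the multiscale integration consumes in order (Benfatto–Giuliani–Mastropietro 2006, (2.9)–(2.12): `g = g^{(u.v.)} + Σ_h g^{(h)}`;
Salmhofer 1999 §4.2.5 (4.70)):

`C = R_M + C_{uv} + Σ_{j<K} C_{(Λ_{j+1}, Λ_j]} + C_{≤Λ_K}`, where (`χ_n = 1 - |n|/M` the Fejér top weight, `w_Λ` Salmhofer's cutoff weight
`χ₂((ω²+ξ²)/Λ²)`, `Λ_0 ≥ Λ_1 ≥ ⋯ ≥ Λ_K`):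

* `R_M` = `hubbardCovTopShifted` — symbol `(1 - χ_n) · sym` (the sharp Matsubara edge, of `L¹` size `O(M⁻¹ log M)`);
* `C_{uv}` = `hubbardCovUVShifted … Λ_0` — symbol `(χ_n - 1 + w_{Λ_0}) · sym = χ_n sym - (1 - w_{Λ_0}) sym` (the Fejér-truncated full
  propagator MINUS its infrared part: the block bounded by the row-averaged Pedra–Salmhofer determinant bound);
* `C_{(Λ', Λ]}` = `hubbardCovSliceShifted … Λ' Λ` — symbol `(w_{Λ'} - w_Λ) sym`, Salmhofer's slices (`HubbardShiftedSliceCovariance`);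
* `C_{≤Λ}` = `hubbardCovBelowShifted … Λ` — symbol `(1 - w_Λ) sym`, which VANISHES once `Λ ≤ π/β` (`hubbardCovBelowShifted_eq_zero`:
  every fermionic frequency has `|ω| ≥ π/β`).

* `normalCovariance_add_symbol`, `normalCovariance_sum_symbol`, `normalCovariance_symbol_congr` — linearity of `normalCovariance` in the symbol;
* **`hubbardCovFullShifted_eq_decomposition`** — the identity above; `hubbardCovFullShifted_zero` — at `θ = 0` the full shifted covariance
  is the tree's `hubbardCovariance L M β μ 0`.

Everything is proved; the definitions are the four covariances and the top weight; no named facts.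

## Sources

G. Benfatto, A. Giuliani, V. Mastropietro, Ann. Henri Poincaré 7 (2006) 809–898, §2.2 (2.9)–(2.12) [`BenfattoGiulianiMastropietro2006`];
M. Salmhofer, *Renormalization* (1999), §4.2.5 (4.70)–(4.72) [`Salmhofer1999`].
-/

noncomputable section

namespace Literature.MathematicalPhysics.QuantumLattice

open Literature.Probability.LatticeModels GrassmannAlgebra Finset

/-! ### Linearity of normal covariances in the symbol -/

section Linear

variable {L M : ℕ}

/-- Normal covariances are additive in the symbol (BGM (2.9): `g = g^{(u.v.)} + g^{(i.r.)}` entrywise). [cite: BenfattoGiulianiMastropietro2006, §2.2 (2.9)] -/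
theorem normalCovariance_add_symbol (p p' : FreqMomentum L M × Fin 2 → ℂ) :
    normalCovariance L M (fun ks => p ks + p' ks) = normalCovariance L M p + normalCovariance L M p' := by
  ext X Y
  rw [Matrix.add_apply, normalCovariance_apply, normalCovariance_apply, normalCovariance_apply]
  split_ifs <;> ring

/-- Normal covariances are finitely additive in the symbol (BGM (2.11): `g^{(i.r.)} = Σ_h g^{(h)}`). [cite: BenfattoGiulianiMastropietro2006, §2.2 (2.11)] -/
theorem normalCovariance_sum_symbol {ι : Type*} (s : Finset ι) (p : ι → FreqMomentum L M × Fin 2 → ℂ) :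
    normalCovariance L M (fun ks => ∑ j ∈ s, p j ks) = ∑ j ∈ s, normalCovariance L M (p j) := by
  classical
  induction s using Finset.induction_on with
  | empty =>
    ext X Y
    simp [normalCovariance_apply]
  | insert a s ha ih =>
    rw [Finset.sum_insert ha, ← ih, ← normalCovariance_add_symbol]
    congr 1
    funext ks
    rw [Finset.sum_insert ha]

/-- Normal covariances with pointwise equal symbols agree. [cite: BenfattoGiulianiMastropietro2006, §2.2 (2.9)] -/
theorem normalCovariance_symbol_congr {p p' : FreqMomentum L M × Fin 2 → ℂ} (h : ∀ ks, p ks = p' ks) :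
    normalCovariance L M p = normalCovariance L M p' := by
  rw [show p = p' from funext h]

end Linear

/-! ### The pieces -/

section Pieces

variable (L M : ℕ)

/-- The **Fejér top weight** of a frequency–momentum label: `χ_n = 1 - |n|/M` of its integer Matsubara label.
[cite: Salmhofer1999, §4.2.5 (4.70)] -/
def topWeight (k : FreqMomentum L M) : ℝ := fejerWeight M (matsubaraInt M k.1)

/-- **The full Matsubara-shifted free covariance** `C^θ`: symbol `βL²/(-i(ω+θ) + ξ)` (BGM 2006 (2.3) at complex chemical potential).
[cite: BenfattoGiulianiMastropietro2006, §2.1 (2.3)] -/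
def hubbardCovFullShifted (β μ θ : ℝ) : Matrix (HubbardFieldIdx L M) (HubbardFieldIdx L M) ℂ :=
  normalCovariance L M (shiftedFreeSymbol L M β μ θ)

/-- **The top remainder** `R_M`: symbol `(1 - χ_n) · βL²/(-i(ω+θ)+ξ)` — the sharp Matsubara edge left over by the Fejér truncation.
[cite: Salmhofer1999, §4.2.5 (4.70)] -/
def hubbardCovTopShifted (β μ θ : ℝ) : Matrix (HubbardFieldIdx L M) (HubbardFieldIdx L M) ℂ :=
  normalCovariance L M fun ks => ((1 - topWeight L M ks.1 : ℝ) : ℂ) * shiftedFreeSymbol L M β μ θ ks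

/-- **The ultraviolet block** `C_{uv}`: symbol `(χ_n - 1 + w_{Λ₀}(k)) · βL²/(-i(ω+θ)+ξ)` = Fejér-truncated full propagator minus its
infrared part `(1 - w_{Λ₀}) sym` (BGM (2.9)–(2.10): `g^{(u.v.)}`). [cite: BenfattoGiulianiMastropietro2006, §2.2 (2.10)] -/
def hubbardCovUVShifted (β μ θ Λ₀ : ℝ) : Matrix (HubbardFieldIdx L M) (HubbardFieldIdx L M) ℂ :=
  normalCovariance L M fun ks =>
    ((topWeight L M ks.1 - 1 + hubbardCutoffWeight L M β μ Λ₀ ks.1 : ℝ) : ℂ) * shiftedFreeSymbol L M β μ θ ks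

/-- **The infrared remainder below scale `Λ`**: symbol `(1 - w_Λ(k)) · βL²/(-i(ω+θ)+ξ)` (BGM (2.11): `g^{(≤h)}`).
[cite: BenfattoGiulianiMastropietro2006, §2.2 (2.11)] -/
def hubbardCovBelowShifted (β μ θ Λ : ℝ) : Matrix (HubbardFieldIdx L M) (HubbardFieldIdx L M) ℂ :=
  normalCovariance L M fun ks => ((1 - hubbardCutoffWeight L M β μ Λ ks.1 : ℝ) : ℂ) * shiftedFreeSymbol L M β μ θ ks

variable {L M}

/-- At `θ = 0` the full shifted covariance IS the tree's zero-seed free covariance `hubbardCovariance L M β μ 0`.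
[cite: BenfattoGiulianiMastropietro2006, §2.1 (2.3)] -/
theorem hubbardCovFullShifted_zero [NeZero L] (β μ : ℝ) : hubbardCovFullShifted L M β μ 0 = hubbardCovariance L M β μ 0 := by
  rw [hubbardCovFullShifted, hubbardCovariance_zero_seed]
  refine normalCovariance_symbol_congr fun ks => ?_
  rw [shiftedFreeSymbol_zero]

/-- **Below the lowest fermionic frequency nothing is left**: for `0 < β` and `0 < Λ ≤ π/β` the remainder `C_{≤Λ}` vanishes
(`|ω_n| ≥ π/β ≥ Λ` gives `(ω²+ξ²)/Λ² ≥ 1`, where `χ₂ = 1`). [cite: Salmhofer1999, §4.2.5 (4.71)] -/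
theorem hubbardCovBelowShifted_eq_zero [NeZero L] {β : ℝ} (hβ : 0 < β) (μ θ : ℝ) {Λ : ℝ} (hΛ : 0 < Λ) (hΛβ : Λ ≤ Real.pi / β) :
    hubbardCovBelowShifted L M β μ θ Λ = 0 := by
  rw [hubbardCovBelowShifted]
  have h1 : ∀ ks : FreqMomentum L M × Fin 2, hubbardCutoffWeight L M β μ Λ ks.1 = 1 := by
    intro ks
    rw [hubbardCutoffWeight]
    refine salmhoferCutoff_of_ge ?_
    rw [le_div_iff₀ (pow_pos hΛ 2), one_mul]
    have hω : Λ ≤ |matsubaraFreq β M ks.1.1| := hΛβ.trans (pi_div_le_abs_matsubaraFreq hβ ks.1.1)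
    have hω2 : Λ ^ 2 ≤ matsubaraFreq β M ks.1.1 ^ 2 := by
      rw [← sq_abs (matsubaraFreq β M ks.1.1)]
      exact pow_le_pow_left₀ hΛ.le hω 2
    nlinarith [sq_nonneg (nambuXi L μ ks.1.2)]
  ext X Y
  rw [normalCovariance_apply, Matrix.zero_apply]
  simp [h1]

/-- **The exact scale decomposition**: for any scales `Λ : ℕ → ℝ` and any `K`,
`C^θ = R_M + C_{uv}(Λ_0) + Σ_{j<K} C_{(Λ_{j+1}, Λ_j]} + C_{≤Λ_K}` — a telescoping identity of symbols
(`(1-χ) + (χ - 1 + w_{Λ_0}) + Σ_{j<K}(w_{Λ_{j+1}} - w_{Λ_j}) + (1 - w_{Λ_K}) = 1`).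
[cite: BenfattoGiulianiMastropietro2006, §2.2 (2.9)-(2.12)] -/
theorem hubbardCovFullShifted_eq_decomposition (β μ θ : ℝ) (Λ : ℕ → ℝ) (K : ℕ) :
    hubbardCovFullShifted L M β μ θ =
      hubbardCovTopShifted L M β μ θ + hubbardCovUVShifted L M β μ θ (Λ 0) +
        ∑ j ∈ range K, hubbardCovSliceShifted L M β μ θ (Λ (j + 1)) (Λ j) + hubbardCovBelowShifted L M β μ θ (Λ K) := by
  rw [hubbardCovFullShifted, hubbardCovTopShifted, hubbardCovUVShifted, hubbardCovBelowShifted]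
  simp only [hubbardCovSliceShifted]
  rw [← normalCovariance_sum_symbol, ← normalCovariance_add_symbol, ← normalCovariance_add_symbol, ← normalCovariance_add_symbol]
  refine normalCovariance_symbol_congr fun ks => ?_
  -- the telescoping sum of the slice weights
  have htel : ∑ j ∈ range K, ((hubbardCutoffWeight L M β μ (Λ (j + 1)) ks.1 : ℂ) - (hubbardCutoffWeight L M β μ (Λ j) ks.1 : ℂ)) =
      (hubbardCutoffWeight L M β μ (Λ K) ks.1 : ℂ) - (hubbardCutoffWeight L M β μ (Λ 0) ks.1 : ℂ) :=
    Finset.sum_range_sub (fun j => (hubbardCutoffWeight L M β μ (Λ j) ks.1 : ℂ)) K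
  rw [← Finset.sum_mul, htel]
  push_cast
  ring

end Pieces

end Literature.MathematicalPhysics.QuantumLattice

end
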